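import Mathlib
import Summits.Ventures.PercRepro2.HCov
import Summits.Ventures.PercRepro2.RootLeafUHalf
import Summits.Ventures.PercRepro2.RootLeafUTheorem
import Summits.Ventures.PercRepro2.RootLeafUMixK
import Summits.Ventures.PercRepro2.RootLeafUMixL
import Summits.Ventures.PercRepro2.RootLeafUMixSum
import Summits.Ventures.PercRepro2.RootLeafUMixMax

/-!
# (G4-u): THE MAX-OF-TWO CRITERION — `0 ≤ T2`, hence (HCOV) for a root pendant at an unmarked `u`,
on the MARGINAL class «`max(lowK, lowK₂)/P₀ + max(lowL, lowL₂)/W ≥ 0`» (part 2; the bounds are in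
RootLeafUMixMax; blind cell PercRepro2, p4 g14; S3 item (aa); no definitions)

With the ρ = 1 bounds `lowK/P₀ ≤ T2oK`, `lowL/W ≤ T2oL` (RootLeafUMixSum) and the marginal bounds
`lowK₂/P₀ ≤ T2oK`, `lowL₂/W ≤ T2oL` (RootLeafUMixMax), each half of `T2 = T2oL + T2oK` is at least the
larger of its two bounds, hence

* **`T2_nonneg_of_max_criterion`**: `0 ≤ max (lowK/P₀) (lowK₂/P₀) + max (lowL/W) (lowL₂/W) → 0 ≤ T2`;
* **`HCov_root_leaf_u_of_max_criterion`**: (G4-u) — (HCOV) at `(o, a₁, a₂, c, b)` for `a₁` pendant at `u` from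
  (HCOV) at the smaller instance `(o, u, a₂, c, b)` — on that class.

The class contains the sum class of RootLeafUMixSum.  Census (own code sumclass3.py, 900 random instances
n ≤ 7, three palettes, exact): the sum criterion 88.3 / 83.3 / 82.3 %, the max-of-two criterion
98.3 / 95.7 / 98.0 %; per side `max(lowL, lowL₂) ≥ 0` on 300 / 299 / 300 and `max(lowK, lowK₂) ≥ 0` on
289 / 282 / 284 of 300.  Every quantity in the criterion is a MARGINAL mass of the smaller instance (no
`b`–`o` joint mass): `lowK = (A − 2β)·ℋ′ + ℰ·(e0P₀ − d0P_o)`, `lowK₂ = A·ℋ′ − 2β·P(T′, bK)·P_o + ℰ·(e0P₀ − d0P_o)`,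
`lowL = (|B| − 2β)·δ_o + (OU)·Y`, `lowL₂ = |B|·δ_o − 2β·P(T, bL)·Y + (OU)·Y` (notation of RootLeafUMixSum).
-/

namespace Summit.Ventures.PercRepro2

open UnionCluster CovForm

namespace RootLeafU

section Theorem

variable {V : Type*} {E : Type*} [Fintype E] [DecidableEq E] [Fintype V] [DecidableEq V]
  {R : Type*} [Field R] [LinearOrder R] [IsStrictOrderedRing R]
variable (p : E → R) (ends : E → Sym2 V) (o a₂ c b u : V)

/-- **`0 ≤ T2` on the marginal class `max(lowK, lowK₂)/P₀ + max(lowL, lowL₂)/W ≥ 0`** (contains the sum class of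
`T2_nonneg_of_sum_criterion`). -/
theorem T2_nonneg_of_max_criterion (hp : IsProbVec p)
    (hmax : 0 ≤
      max (((((prob p (PDEvent ends u a₂ c) * prob p (connEvent ends a₂ b) +
            prob p (avoidAll ends a₂ {c}) * gap p ends u a₂ b) +
          (prob p Set.univ * EQb3 p ends u a₂ c b + prob p Set.univ * PDb p ends u a₂ c b +
            prob p (connEvent ends a₂ b) * EQ3 p ends u a₂ c +
            prob p (connEvent ends a₂ b) * prob p (avoidAll ends a₂ {u}) -
            (prob p Set.univ - prob p (avoidAll ends a₂ {c})) * gap p ends u a₂ b)) -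
        2 * (prob p Set.univ * prob p (PDEvent ends u a₂ c) +
          prob p (avoidAll ends a₂ {c}) * prob p (avoidAll ends a₂ {u}))) *
        (prob p (TEvent ends a₂ u c) * prob p (PDEvent ends u a₂ c ∩ connEvent ends a₂ o) -
          prob p (PDEvent ends u a₂ c) * prob p (TEvent ends a₂ u c ∩ connEvent ends a₂ o)) +
      Ee p ends a₂ c b u *
        (prob p (avoidAll ends a₂ {c} ∩ connEvent ends a₂ o) *
            (prob p (PDEvent ends u a₂ c) + prob p (TEvent ends a₂ u c)) -
          prob p (avoidAll ends a₂ {c}) *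
            (prob p (PDEvent ends u a₂ c ∩ connEvent ends a₂ o) +
              prob p (TEvent ends a₂ u c ∩ connEvent ends a₂ o)))) /
        (prob p (PDEvent ends u a₂ c) + prob p (TEvent ends a₂ u c)))
        ((((prob p (PDEvent ends u a₂ c) * prob p (connEvent ends a₂ b) +
            prob p (avoidAll ends a₂ {c}) * gap p ends u a₂ b) +
          (prob p Set.univ * EQb3 p ends u a₂ c b + prob p Set.univ * PDb p ends u a₂ c b +
            prob p (connEvent ends a₂ b) * EQ3 p ends u a₂ c +
            prob p (connEvent ends a₂ b) * prob p (avoidAll ends a₂ {u}) -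
            (prob p Set.univ - prob p (avoidAll ends a₂ {c})) * gap p ends u a₂ b)) *
        (prob p (TEvent ends a₂ u c) * prob p (PDEvent ends u a₂ c ∩ connEvent ends a₂ o) -
          prob p (PDEvent ends u a₂ c) * prob p (TEvent ends a₂ u c ∩ connEvent ends a₂ o)) -
      2 * (prob p Set.univ * prob p (PDEvent ends u a₂ c) +
          prob p (avoidAll ends a₂ {c}) * prob p (avoidAll ends a₂ {u})) *
        (prob p (TEvent ends a₂ u c ∩ connEvent ends a₂ b) *
          (prob p (PDEvent ends u a₂ c ∩ connEvent ends a₂ o) +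
            prob p (TEvent ends a₂ u c ∩ connEvent ends a₂ o))) +
      Ee p ends a₂ c b u *
        (prob p (avoidAll ends a₂ {c} ∩ connEvent ends a₂ o) *
            (prob p (PDEvent ends u a₂ c) + prob p (TEvent ends a₂ u c)) -
          prob p (avoidAll ends a₂ {c}) *
            (prob p (PDEvent ends u a₂ c ∩ connEvent ends a₂ o) +
              prob p (TEvent ends a₂ u c ∩ connEvent ends a₂ o)))) /
        (prob p (PDEvent ends u a₂ c) + prob p (TEvent ends a₂ u c))) +
      max ((((prob p Set.univ * EQb3 p ends u a₂ c b + prob p Set.univ * PDb p ends u a₂ c b +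
            prob p (connEvent ends a₂ b) * EQ3 p ends u a₂ c +
            prob p (connEvent ends a₂ b) * prob p (avoidAll ends a₂ {u}) -
            (prob p Set.univ - prob p (avoidAll ends a₂ {c})) * gap p ends u a₂ b) -
          (prob p (PDEvent ends u a₂ c) * prob p (connEvent ends a₂ b) +
            prob p (avoidAll ends a₂ {c}) * gap p ends u a₂ b) -
        2 * (prob p Set.univ * prob p (PDEvent ends u a₂ c) +
          prob p (avoidAll ends a₂ {c}) * prob p (avoidAll ends a₂ {u}))) *
        (prob p (TEvent ends u a₂ c) * prob p (PDEvent ends u a₂ c ∩ connEvent ends u o) -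
          prob p (PDEvent ends u a₂ c) * prob p (TEvent ends u a₂ c ∩ connEvent ends u o)) +
      T2oL p ends u a₂ c b u *
        (prob p (PDEvent ends u a₂ c ∩ connEvent ends u o) +
          prob p (TEvent ends u a₂ c ∩ connEvent ends u o))) /
        (prob p (PDEvent ends u a₂ c) + prob p (TEvent ends u a₂ c)))
        ((((prob p Set.univ * EQb3 p ends u a₂ c b + prob p Set.univ * PDb p ends u a₂ c b +
            prob p (connEvent ends a₂ b) * EQ3 p ends u a₂ c +
            prob p (connEvent ends a₂ b) * prob p (avoidAll ends a₂ {u}) -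
            (prob p Set.univ - prob p (avoidAll ends a₂ {c})) * gap p ends u a₂ b) -
          (prob p (PDEvent ends u a₂ c) * prob p (connEvent ends a₂ b) +
            prob p (avoidAll ends a₂ {c}) * gap p ends u a₂ b)) *
        (prob p (TEvent ends u a₂ c) * prob p (PDEvent ends u a₂ c ∩ connEvent ends u o) -
          prob p (PDEvent ends u a₂ c) * prob p (TEvent ends u a₂ c ∩ connEvent ends u o)) -
      2 * (prob p Set.univ * prob p (PDEvent ends u a₂ c) +
          prob p (avoidAll ends a₂ {c}) * prob p (avoidAll ends a₂ {u})) *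
        (prob p (TEvent ends u a₂ c ∩ connEvent ends u b) *
          (prob p (PDEvent ends u a₂ c ∩ connEvent ends u o) +
            prob p (TEvent ends u a₂ c ∩ connEvent ends u o))) +
      T2oL p ends u a₂ c b u *
        (prob p (PDEvent ends u a₂ c ∩ connEvent ends u o) +
          prob p (TEvent ends u a₂ c ∩ connEvent ends u o))) /
        (prob p (PDEvent ends u a₂ c) + prob p (TEvent ends u a₂ c)))) :
    0 ≤ T2 p ends o a₂ c b u := by
  have hK1 := MixK.lowK_div_le_T2oK p ends o a₂ c b u hp
  have hK2 := MixK.lowK2_div_le_T2oK p ends o a₂ c b u hp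
  have hL1 := MixL.lowL_div_le_T2oL p ends o a₂ c b u hp
  have hL2 := MixL.lowL2_div_le_T2oL p ends o a₂ c b u hp
  have hK := max_le hK1 hK2
  have hL := max_le hL1 hL2
  rw [T2_eq_T2oL_add_T2oK]
  linarith

/-- **(G4-u) on the marginal class**: (HCOV) for a root `a₁` pendant at the unmarked `u` follows from (HCOV)
at the smaller instance `(o, u, a₂, c, b)` whenever `max(lowK, lowK₂)/P₀ + max(lowL, lowL₂)/W ≥ 0` there. -/
theorem HCov_root_leaf_u_of_max_criterion (hp : IsProbVec p) {f : E} {a₁ : V} (hf : ends f = s(a₁, u))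
    (hleaf : ∀ e, a₁ ∈ ends e → e = f) (h1u : a₁ ≠ u) (h12 : a₁ ≠ a₂) (h1c : a₁ ≠ c)
    (h1o : a₁ ≠ o) (h1b : a₁ ≠ b)
    (hmax : 0 ≤
      max (((((prob p (PDEvent ends u a₂ c) * prob p (connEvent ends a₂ b) +
            prob p (avoidAll ends a₂ {c}) * gap p ends u a₂ b) +
          (prob p Set.univ * EQb3 p ends u a₂ c b + prob p Set.univ * PDb p ends u a₂ c b +
            prob p (connEvent ends a₂ b) * EQ3 p ends u a₂ c +
            prob p (connEvent ends a₂ b) * prob p (avoidAll ends a₂ {u}) -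
            (prob p Set.univ - prob p (avoidAll ends a₂ {c})) * gap p ends u a₂ b)) -
        2 * (prob p Set.univ * prob p (PDEvent ends u a₂ c) +
          prob p (avoidAll ends a₂ {c}) * prob p (avoidAll ends a₂ {u}))) *
        (prob p (TEvent ends a₂ u c) * prob p (PDEvent ends u a₂ c ∩ connEvent ends a₂ o) -
          prob p (PDEvent ends u a₂ c) * prob p (TEvent ends a₂ u c ∩ connEvent ends a₂ o)) +
      Ee p ends a₂ c b u *
        (prob p (avoidAll ends a₂ {c} ∩ connEvent ends a₂ o) *
            (prob p (PDEvent ends u a₂ c) + prob p (TEvent ends a₂ u c)) -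
          prob p (avoidAll ends a₂ {c}) *
            (prob p (PDEvent ends u a₂ c ∩ connEvent ends a₂ o) +
              prob p (TEvent ends a₂ u c ∩ connEvent ends a₂ o)))) /
        (prob p (PDEvent ends u a₂ c) + prob p (TEvent ends a₂ u c)))
        ((((prob p (PDEvent ends u a₂ c) * prob p (connEvent ends a₂ b) +
            prob p (avoidAll ends a₂ {c}) * gap p ends u a₂ b) +
          (prob p Set.univ * EQb3 p ends u a₂ c b + prob p Set.univ * PDb p ends u a₂ c b +
            prob p (connEvent ends a₂ b) * EQ3 p ends u a₂ c +
            prob p (connEvent ends a₂ b) * prob p (avoidAll ends a₂ {u}) -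
            (prob p Set.univ - prob p (avoidAll ends a₂ {c})) * gap p ends u a₂ b)) *
        (prob p (TEvent ends a₂ u c) * prob p (PDEvent ends u a₂ c ∩ connEvent ends a₂ o) -
          prob p (PDEvent ends u a₂ c) * prob p (TEvent ends a₂ u c ∩ connEvent ends a₂ o)) -
      2 * (prob p Set.univ * prob p (PDEvent ends u a₂ c) +
          prob p (avoidAll ends a₂ {c}) * prob p (avoidAll ends a₂ {u})) *
        (prob p (TEvent ends a₂ u c ∩ connEvent ends a₂ b) *
          (prob p (PDEvent ends u a₂ c ∩ connEvent ends a₂ o) +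
            prob p (TEvent ends a₂ u c ∩ connEvent ends a₂ o))) +
      Ee p ends a₂ c b u *
        (prob p (avoidAll ends a₂ {c} ∩ connEvent ends a₂ o) *
            (prob p (PDEvent ends u a₂ c) + prob p (TEvent ends a₂ u c)) -
          prob p (avoidAll ends a₂ {c}) *
            (prob p (PDEvent ends u a₂ c ∩ connEvent ends a₂ o) +
              prob p (TEvent ends a₂ u c ∩ connEvent ends a₂ o)))) /
        (prob p (PDEvent ends u a₂ c) + prob p (TEvent ends a₂ u c))) +
      max ((((prob p Set.univ * EQb3 p ends u a₂ c b + prob p Set.univ * PDb p ends u a₂ c b +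
            prob p (connEvent ends a₂ b) * EQ3 p ends u a₂ c +
            prob p (connEvent ends a₂ b) * prob p (avoidAll ends a₂ {u}) -
            (prob p Set.univ - prob p (avoidAll ends a₂ {c})) * gap p ends u a₂ b) -
          (prob p (PDEvent ends u a₂ c) * prob p (connEvent ends a₂ b) +
            prob p (avoidAll ends a₂ {c}) * gap p ends u a₂ b) -
        2 * (prob p Set.univ * prob p (PDEvent ends u a₂ c) +
          prob p (avoidAll ends a₂ {c}) * prob p (avoidAll ends a₂ {u}))) *
        (prob p (TEvent ends u a₂ c) * prob p (PDEvent ends u a₂ c ∩ connEvent ends u o) -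
          prob p (PDEvent ends u a₂ c) * prob p (TEvent ends u a₂ c ∩ connEvent ends u o)) +
      T2oL p ends u a₂ c b u *
        (prob p (PDEvent ends u a₂ c ∩ connEvent ends u o) +
          prob p (TEvent ends u a₂ c ∩ connEvent ends u o))) /
        (prob p (PDEvent ends u a₂ c) + prob p (TEvent ends u a₂ c)))
        ((((prob p Set.univ * EQb3 p ends u a₂ c b + prob p Set.univ * PDb p ends u a₂ c b +
            prob p (connEvent ends a₂ b) * EQ3 p ends u a₂ c +
            prob p (connEvent ends a₂ b) * prob p (avoidAll ends a₂ {u}) -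
            (prob p Set.univ - prob p (avoidAll ends a₂ {c})) * gap p ends u a₂ b) -
          (prob p (PDEvent ends u a₂ c) * prob p (connEvent ends a₂ b) +
            prob p (avoidAll ends a₂ {c}) * gap p ends u a₂ b)) *
        (prob p (TEvent ends u a₂ c) * prob p (PDEvent ends u a₂ c ∩ connEvent ends u o) -
          prob p (PDEvent ends u a₂ c) * prob p (TEvent ends u a₂ c ∩ connEvent ends u o)) -
      2 * (prob p Set.univ * prob p (PDEvent ends u a₂ c) +
          prob p (avoidAll ends a₂ {c}) * prob p (avoidAll ends a₂ {u})) *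
        (prob p (TEvent ends u a₂ c ∩ connEvent ends u b) *
          (prob p (PDEvent ends u a₂ c ∩ connEvent ends u o) +
            prob p (TEvent ends u a₂ c ∩ connEvent ends u o))) +
      T2oL p ends u a₂ c b u *
        (prob p (PDEvent ends u a₂ c ∩ connEvent ends u o) +
          prob p (TEvent ends u a₂ c ∩ connEvent ends u o))) /
        (prob p (PDEvent ends u a₂ c) + prob p (TEvent ends u a₂ c))))
    (h3 : HCov p ends o u a₂ c b) : HCov p ends o a₁ a₂ c b :=
  HCov_root_leaf_u_of p ends hp hf hleaf h1u h12 h1c h1o h1b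
    (T2_nonneg_of_max_criterion p ends o a₂ c b u hp hmax) h3

end Theorem

end RootLeafU

end Summit.Ventures.PercRepro2
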